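import Summits.CriticalPhenomena.SAWScalingLimit.Theses.SAWReversalUpgrade
import Summits.CriticalPhenomena.SAWScalingLimit.Theorems.SAWReversalUpgradePathUpgradeRUpgradeOfReturns
import Summits.CriticalPhenomena.SAWScalingLimit.Theorems.SAWReversalUpgradePathUpgradeRLawClosed
import Summits.CriticalPhenomena.SAWScalingLimit.Theorems.SAWReversalUpgradePathUpgradeRSLEHullPackage
import Summits.CriticalPhenomena.SAWScalingLimit.Theorems.SAWReversalUpgradePathUpgradeRLatticeDictionary
import Summits.CriticalPhenomena.SAWScalingLimit.Theorems.SAWReversalUpgradePathUpgradeRHullHausdorff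
import Summits.CriticalPhenomena.SAWScalingLimit.Theorems.SAWReversalUpgradePathUpgradeRRangeBound
import Summits.CriticalPhenomena.SAWScalingLimit.Theorems.SAWReversalUpgradePathUpgradeRGate
import Summits.CriticalPhenomena.SAWScalingLimit.Theorems.SAWReversalUpgradePathUpgradeRCompat
import Summits.CriticalPhenomena.SAWScalingLimit.Theorems.SAWReversalUpgradePathUpgradeRFlank
import Summits.CriticalPhenomena.SAWScalingLimit.Theorems.SAWReversalUpgradePathUpgradeRReturnsDie
import Literature.Probability.RandomPlanarGeometry.SLE
import Literature.Probability.RandomPlanarGeometry.LoewnerDescription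
import Literature.Probability.RandomPlanarGeometry.LocalMartingaleProofs
import Literature.Probability.RandomPlanarGeometry.SeparatedTraces
import Mathlib.MeasureTheory.Constructions.BorelSpace.Basic
import Mathlib.Analysis.Convex.Segment
import Literature.Probability.RandomPlanarGeometry.LoewnerInverse

/-!
# Crux `PathUpgradeR` (stmt-CriticalPhenomena-18055, route `SAWReversalUpgrade`, rank 4) —
line `bidir_windows`, skeleton RESHAPED by the line lead (prover-line-stmt-CriticalPhenomena-18055)

The crux: random SIMPLE curves `X δ ω` from `a = D.pt 0` to `b = D.pt 1` in a Dobrushin domain,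
with (H4) forward chordal driving functions through `φ` and (H5) the reversals' driving functions
through `φ'` (uniformizer of `D.swap`) both converging in law on every `[0, T]` to `√(8/3) B`,
(H6) no deep return to `a`, (H7) no escape from `b`, converge in law in `CurveClass ℂ` to chordal
SLE_{8/3} (`ConvergesInLawToSLE (8/3) D (mk ∘ X) P`).

## Shape of the line (strategist's thesis kept: RANGE from the forward evolution, ORDER from both,
then the tree's proved curve upgrade) and the lead's reshape

The strategist's `stub_rangeLaw` (size L) is cut at the measure-theory / Loewner seam and the whole
weak-convergence plumbing of the line is isolated in ONE generic stub, so that no stub needs a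
Skorokhod coupling or a joint law of the two drivers (neither exists in Mathlib or the tree):

* `stub_hullHausdorff` (deterministic Loewner, M/L; LANDED p161175): Hausdorff stability of closed hulls at simple-curve chains.
* `stub_lawClosed` (generic measure theory, M; LANDED p160537): along the mesh filter `𝓝[>] 0`, with eventually-
  probability laws and eventually-a.e.-measurable random elements of a (pseudo-e)metric Borel space,
  `TendstoLaw Y P Z P'` is EQUIVALENT to the closed-set bound
  `∀ F closed, ∀ β > 0, ∀ᶠ δ, P δ (Y δ ⁻¹' F) ≤ P' (Z ⁻¹' F) + β` (portmanteau, Billingsley Thm 2.1,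
  after normalising the finitely many... the eventually-bad indices). Direction `→` is how H4/H5
  are CONSUMED everywhere below (one direction at a time: union bounds only); direction `←` is how
  the range law is PRODUCED.
* `stub_sleHullPackage` (SLE side, M; LANDED p160796): `HullHausdorff →` for every `(D, φ)` and `T > 0`, for
  Wiener-a.e. `ω`: `closure K_T(√κB) = γ[0,T]` (a.e. simple trace, `κ = 8/3 ≤ 4`) and the map
  `W ↦ φ̄ (closure K_T(W))` is CONTINUOUS at `√κ B(ω)` for the sup-norm on `[0,T]` (a.e. no real
  point is swallowed: `sle_swallowingTime_ofReal_eq_top_holds` + reflection); and a.e. the tip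
  `φ̄ (γ t) → b` (transience, `tendsto_norm_sleTrace_atTop_of_ne_eight`).
* `stub_latticeDictionary` (deterministic, M; LANDED p160945): a SIMPLE curve `X` from `a` to `b`, interior in `D`,
  whose class is described through `φ` by `W` (`IsLoewnerDescribed`) has a simple trace
  `γ = trace W`, `closure K_T(W) = γ[0,T]`, and `X[0,u₀] = φ̄ (γ[0,T])` for some `u₀` with
  `X u₀ = φ̄ (γ T)` (monotone-reparametrisation lemma + `hcap K_t = 2t`); and capacity `≥ T₀(r)`
  forces an `r`-approach of `b` (`two_mul_le_of_hull_subset_closedBall`).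
* `stub_rangeBound` (assembly of RANGE, M/L; LANDED p162480 + aux p161678): from the three previous statements and H1 H2 H3 H4 H7:
  an SLE_{8/3} curve `Γ` and the closed-set bound for the ranges in `NonemptyCompacts ℂ`
  (`{range X ∈ F} ⊆ {W^δ|[0,T] ∈ A} ∪ tail-bad ∪ non-describable`, `closure A ⊆ A ∪ Disc(Φ_T)`,
  `P'(Disc) = 0`, atomlessness of `B_T` for the junk driver `0`, H7 + capacity for the lattice tail,
  transience for the SLE tail, `tendsto_measure_cthickening_of_isClosed`).
* `stub_returnsDie` (ORDER, XL) = `stub_returnsDieOfGFC` (lead) ∘ (`stub_gate`, `stub_flank`, `stub_compat`) (wave 2): returns die in law, from everything above and H1–H7 by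
  the two-direction UNION BOUND `P(return) ≤ P(W^δ ∈ cl Bad_f) + P(V^δ ∈ cl Bad_b) + P(H6/H7 windows
  fail) + P(non-describable)` and a DETERMINISTIC core (record-time Wolff gates: a sub-front move of
  small capacity with small driver oscillation is conformally pinned to the tip, hence behind a short
  crosscut, hence flanked by the past along any transversal; a level drawdown makes every strand
  point on a mid-level transversal forward- or backward-sub-front; the extremal strand point is a
  contradiction).  Witnesses honoured: N-curve (H6/H7: windows), Lawler Ex. 4.49 herringbone (H5:
  the reversed ribs slide along the exposed face of the pencil-shaped backward hull ⇒ backward driver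
  oscillation at zero capacity).
* `stub_upgradeOfReturns` (soft, M): LANDED, p158138,
  `Theorems/SAWReversalUpgradePathUpgradeRUpgradeOfReturns.lean`.

Composition `PathUpgradeR_of`: real glue (~40 lines): the range `TendstoLaw` is obtained from
`stub_rangeBound` by `stub_lawClosed` (`←`, with `borel` on `NonemptyCompacts ℂ` and the
`1`-Lipschitz range map), then `stub_upgradeOfReturns`.
-/


namespace Summit.CriticalPhenomena.SAWScalingLimit.Cruxes.PathUpgradeR.BidirWindows

/-! ### The named statements of the line (each `stub_*` below has VERBATIM the same text) -/

/-- `HullHausdorff` — Hausdorff stability of closed Loewner hulls at simple-curve chains (deterministic):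
drivers `W n → V` uniformly on `[0,T]`, chain of `V` generated by a simple curve `γ`, no real point but
`V 0` swallowed by `T` ⟹ `closure K_T(W n) → γ[0,T]` in Hausdorff distance. -/
def HullHausdorff : Prop :=
  ∀ (W : ℕ → NNReal → ℝ) (V : NNReal → ℝ) (γ : NNReal → ℂ) (T : NNReal), 0 < T → (∀ n, Continuous (W n)) → Continuous V → Literature.Probability.RandomPlanarGeometry.Loewner.IsGeneratedByCurve V γ → Literature.Probability.RandomPlanarGeometry.Loewner.IsSimpleTrace γ → (∀ x : ℝ, x ≠ V 0 → (T : WithTop NNReal) < Literature.Probability.RandomPlanarGeometry.Loewner.swallowingTime V (x : ℂ)) → TendstoUniformlyOn W V Filter.atTop (Set.Icc 0 T) → Filter.Tendsto (fun n => Metric.hausdorffDist (closure (Literature.Probability.RandomPlanarGeometry.Loewner.hull (W n) T)) (γ '' Set.Icc 0 T)) Filter.atTop (nhds 0)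

/-- `LawClosed` — the closed-set form of the portmanteau theorem along the mesh filter, as an
EQUIVALENCE with the tree's `TendstoLaw` (bounded continuous test functions), for eventually-probability
laws `P δ`, eventually a.e.-measurable `Y δ`, a probability law `P'` and a.e.-measurable `Z`, with values
in a pseudo-emetric Borel space. Billingsley (1999) Thm 2.1; Mathlib `Portmanteau`. -/
def LawClosed : Prop :=
  ∀ (S : Type) [PseudoEMetricSpace S] [MeasurableSpace S] [BorelSpace S] (Ωδ : ℝ → Type) [∀ δ, MeasurableSpace (Ωδ δ)] (Ω' : Type) [MeasurableSpace Ω'] (Y : (δ : ℝ) → Ωδ δ → S) (P : (δ : ℝ) → MeasureTheory.Measure (Ωδ δ)) (Z : Ω' → S) (P' : MeasureTheory.Measure Ω'), MeasureTheory.IsProbabilityMeasure P' → (∀ᶠ δ in (nhdsWithin (0:ℝ) (Set.Ioi 0)), MeasureTheory.IsProbabilityMeasure (P δ)) → (∀ᶠ δ in (nhdsWithin (0:ℝ) (Set.Ioi 0)), AEMeasurable (Y δ) (P δ)) → AEMeasurable Z P' → (Literature.Probability.RandomPlanarGeometry.TendstoLaw Y P Z P' ↔ ∀ F : Set S, IsClosed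 F → ∀ β : ENNReal, 0 < β → ∀ᶠ δ in (nhdsWithin (0:ℝ) (Set.Ioi 0)), P δ (Y δ ⁻¹' F) ≤ P' (Z ⁻¹' F) + β)

/-- `SLEHullPackage` — SLE_(8/3)-side regularity: for every `(D, φ)` and `T > 0`, Wiener-a.e.,
`closure K_T(√κB) = sleTrace[0,T]` and `W ↦ φ̄ '' closure K_T(W)` is continuous at `√κB` for the
sup-norm on `[0,T]`; and a.e. `φ̄ (sleTrace t) → b`. -/
def SLEHullPackage : Prop :=
  ∀ (D : Literature.Probability.RandomPlanarGeometry.DobrushinDomain) (φ : Literature.Probability.RandomPlanarGeometry.ConformalEquiv UpperHalfPlane.upperHalfPlaneSet D.carrier), D.IsChordalUniformizing φ → (∀ T : NNReal, 0 < T → ∀ᵐ ω ∂Literature.Probability.Process.preWienerMeasure, closure (Literature.Probability.RandomPlanarGeometry.Loewner.hull (Literature.Probability.RandomPlanarGeometry.sleDriving ((8:NNReal)/3) ω) T) = Literature.Probability.RandomPlanarGeometry.sleTrace ((8:NNReal)/3) ω '' Set.Icc 0 T ∧ ∀ ε : ℝ, 0 < ε → ∃ ρ : ℝ, 0 < ρ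 ∧ ∀ W' : NNReal → ℝ, Continuous W' → (∀ s : NNReal, s ≤ T → |W' s - Literature.Probability.RandomPlanarGeometry.sleDriving ((8:NNReal)/3) ω s| ≤ ρ) → Metric.hausdorffDist (φ.boundaryExtension '' closure (Literature.Probability.RandomPlanarGeometry.Loewner.hull W' T)) (φ.boundaryExtension '' closure (Literature.Probability.RandomPlanarGeometry.Loewner.hull (Literature.Probability.RandomPlanarGeometry.sleDriving ((8:NNReal)/3) ω) T)) ≤ ε) ∧ (∀ᵐ ω ∂Literature.Probability.Process.preWienerMeasure, ∀ ε : ℝ, 0 < ε → ∃ T₀ : NNReal, ∀ t : NNReal, T₀ ≤ t → dist (φ.boundaryExtension (Literature.Probability.RandomPlanarGeometry.sleTrace ((8:NNReal)/3) ω t)) (D.pt 1) ≤ ε)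

/-- `LatticeDictionary` — deterministic dictionary for a SIMPLE described curve, and "capacity forces an
approach of `b`". -/
def LatticeDictionary : Prop :=
  ∀ (D : Literature.Probability.RandomPlanarGeometry.DobrushinDomain) (φ : Literature.Probability.RandomPlanarGeometry.ConformalEquiv UpperHalfPlane.upperHalfPlaneSet D.carrier), D.IsChordalUniformizing φ → (∀ (X : Literature.Probability.RandomPlanarGeometry.Curve ℂ) (W : NNReal → ℝ), Function.Injective X → X.source = D.pt 0 → X.target = D.pt 1 → (∀ t : unitInterval, X t = D.pt 0 ∨ X t = D.pt 1 ∨ X t ∈ D.carrier) → Literature.Probability.RandomPlanarGeometry.IsLoewnerDescribed φ (Literature.Probability.RandomPlanarGeometry.CurveClass.mk X) W → Literature.Probability.RandomPlanarGeometry.Loewner.IsSimpleTrace (Literature.Probability.RandomPlanarGeometry.Loewner.trace W) ∧ (∀ T : NNReal, 0 < T → closure (Literature.Probability.RandomPlanarGeometry.Loewner.hull W T) = Literature.Probability.RandomPlanarGeometry.Loewner.trace W '' Set.Icc 0 T) ∧ (∀ T : NNReal, ∃ u₀ : unitInterval, X u₀ = φ.boundaryExtension (Literature.Probability.RandomPlanarGeometry.Loewner.trace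 W T) ∧ X '' Set.Icc 0 u₀ = φ.boundaryExtension '' (Literature.Probability.RandomPlanarGeometry.Loewner.trace W '' Set.Icc 0 T))) ∧ (∀ r : ℝ, 0 < r → ∃ T₀ : NNReal, ∀ (W : NNReal → ℝ) (γ : NNReal → ℂ), Continuous W → Literature.Probability.RandomPlanarGeometry.Loewner.IsGeneratedByCurve W γ → ∀ T : NNReal, T₀ ≤ T → ∃ t : NNReal, t ≤ T ∧ dist (φ.boundaryExtension (γ t)) (D.pt 1) < r)

/-- `RangeBound` — RANGE as a closed-set bound (the three landed statements `LawClosed`, `SLEHullPackage`,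
`LatticeDictionary` are used INSIDE its proof; stub signatures are capped at 4000 characters by the gate): from
H1 H2 H3 H4 H7, an SLE_(8/3) curve `Γ` of `D` with
`∀ F closed ⊆ NonemptyCompacts ℂ, ∀ β > 0, ∀ᶠ δ, P δ {range X ∈ F} ≤ P' {range Γ ∈ F} + β`. -/
def RangeBound : Prop :=
  ∀ (D : Literature.Probability.RandomPlanarGeometry.DobrushinDomain) (φ : Literature.Probability.RandomPlanarGeometry.ConformalEquiv UpperHalfPlane.upperHalfPlaneSet D.carrier), D.IsChordalUniformizing φ → ∀ (Ω : ℝ → Type) [∀ δ, MeasurableSpace (Ω δ)] (X : (δ : ℝ) → Ω δ → Literature.Probability.RandomPlanarGeometry.Curve ℂ) (P : (δ : ℝ) → MeasureTheory.Measure (Ω δ)), (∀ᶠ δ in (nhdsWithin (0:ℝ) (Set.Ioi 0)), MeasureTheory.IsProbabilityMeasure (P δ)) → (∀ᶠ δ in (nhdsWithin (0:ℝ) (Set.Ioi 0)), AEMeasurable (fun ω => Literature.Probability.RandomPlanarGeometry.CurveClass.mk (X δ ω)) (P δ)) → (∀ᶠ δ in (nhdsWithin (0:ℝ) (Set.Ioi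 0)), ∀ ω : Ω δ, Function.Injective (X δ ω) ∧ (X δ ω).source = D.pt 0 ∧ (X δ ω).target = D.pt 1 ∧ ∀ t : unitInterval, X δ ω t = D.pt 0 ∨ X δ ω t = D.pt 1 ∨ X δ ω t ∈ D.carrier) → (∀ T : NNReal, Literature.Probability.RandomPlanarGeometry.TendstoLaw (fun δ (ω : Ω δ) => ((⟨Literature.Probability.RandomPlanarGeometry.drivingFunction (φ) (Literature.Probability.RandomPlanarGeometry.CurveClass.mk (X δ ω)), Literature.Probability.RandomPlanarGeometry.continuous_drivingFunction (φ) (Literature.Probability.RandomPlanarGeometry.CurveClass.mk (X δ ω))⟩ : C(NNReal, ℝ)).restrict (Set.Icc (0:NNReal) T))) P (fun ω : NNReal → ℝ => ((⟨Literature.Probability.RandomPlanarGeometry.sleDriving ((8:NNReal)/3) ω, Literature.Probability.RandomPlanarGeometry.continuous_sleDriving ((8:NNReal)/3) ω⟩ : C(NNReal, ℝ)).restrict (Set.Icc (0:NNReal) T))) Literature.Probability.Process.preWienerMeasure) → (∀ ε : ℝ, 0 < ε → ∀ η : ℝ, 0 < η → ∃ r : ℝ, 0 < r ∧ ∀ᶠ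 δ in (nhdsWithin (0:ℝ) (Set.Ioi 0)), P δ {ω | ∃ s t : unitInterval, s < t ∧ dist (X δ ω s) (D.pt 1) ≤ r ∧ ε ≤ dist (X δ ω t) (D.pt 1)} ≤ ENNReal.ofReal η) → ∃ Γ : (NNReal → ℝ) → Literature.Probability.RandomPlanarGeometry.CurveClass ℂ, Literature.Probability.RandomPlanarGeometry.IsSLECurve ((8:NNReal)/3) D Γ ∧ ∀ F : Set (TopologicalSpace.NonemptyCompacts ℂ), IsClosed F → ∀ β : ENNReal, 0 < β → ∀ᶠ δ in (nhdsWithin (0:ℝ) (Set.Ioi 0)), P δ {ω | (⟨⟨(Literature.Probability.RandomPlanarGeometry.CurveClass.mk (X δ ω)).range, (Literature.Probability.RandomPlanarGeometry.CurveClass.mk (X δ ω)).isCompact_range⟩, (Literature.Probability.RandomPlanarGeometry.CurveClass.mk (X δ ω)).range_nonempty⟩ : TopologicalSpace.NonemptyCompacts ℂ) ∈ F} ≤ Literature.Probability.Process.preWienerMeasure {ω | (⟨⟨(Γ ω).range, (Γ ω).isCompact_range⟩, (Γ ω).range_nonempty⟩ : TopologicalSpace.NonemptyCompacts ℂ) ∈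 F} + β

/-- `Gate` — uniform Wolff gate in a Loewner chain: for `M, λ, R_out > 0` there is `r₁ > 0` such that for every
Dobrushin domain `E ⊆ ball c M` with uniformizer `ψ`, every continuous driver `U` and time `t₁`, the domain
`ψ (ℍ ∖ K_{t₁})` splits as `P ⊔ Q ⊔ C` with `C` of diameter `≤ λ` (a crosscut), preconnected subsets of `P ∪ Q` on one
side, the conformal `r₁`-neighbourhood of the tip (`‖g_{t₁} - U t₁‖ ≤ r₁`) inside `P`, and conformal distance `≥ R_out`
inside `Q` (Pommerenke 1992 Prop. 2.2/2.3 = tree `LengthArea.exists_radius_forall_short_crosscut_of_subset_ball`, Cayley transport). -/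
def Gate : Prop :=
  ∀ (M lam Rout : ℝ), 0 < M → 0 < lam → 0 < Rout → ∃ r₁ : ℝ, 0 < r₁ ∧ ∀ (E : Literature.Probability.RandomPlanarGeometry.DobrushinDomain) (ψ : Literature.Probability.RandomPlanarGeometry.ConformalEquiv UpperHalfPlane.upperHalfPlaneSet E.carrier) (c : ℂ), E.carrier ⊆ Metric.ball c M → ∀ (U : NNReal → ℝ), Continuous U → ∀ t₁ : NNReal, ∃ C P Q : Set ℂ, (∀ p ∈ C, ∀ q ∈ C, dist p q ≤ lam) ∧ Disjoint P Q ∧ Disjoint P C ∧ Disjoint Q C ∧ P ∪ Q ∪ C = ψ '' (Literature.Probability.RandomPlanarGeometry.Loewner.domain U t₁) ∧ (∀ S : Set ℂ, IsPreconnected S → S ⊆ P ∪ Q → S ⊆ P ∨ S ⊆ Q) ∧ (∀ y : ℂ, 0 < y.im → dist y (U t₁) ≤ r₁ → ψ (Literature.Probability.RandomPlanarGeometry.Loewner.loewnerInv U t₁ y) ∈ P) ∧ (∀ y : ℂ, 0 < y.im → Rout ≤ dist y (U t₁) → ψ (Literature.Probability.RandomPlanarGeometry.Loewner.loewnerInv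 U t₁ y) ∈ Q)

/-- `Flank` — the deterministic FLANK LEMMA (one direction): in a Loewner chain `(U, ζ)` with simple trace whose hulls
are `ε`-shadowed (through `ψ̄`) by a reference curve `r = ψ̄ ∘ ρ` with injectivity/continuity moduli, whose driver has
oscillation `≤ ρ₁` on capacity windows of length `θ + 4w`, with the gate point / far points conformally far from the tip
and a gate decomposition at every `t₁ ≤ T`: a `c₀`-SUB-FRONT point `ψ̄ (ζ t)` is flanked by its past along every short
segment towards a far point `e` (`∃ s < t, ψ̄ (ζ s) ∈ segment (ψ̄ (ζ t)) e`). -/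
def Flank : Prop :=
  ∀ (E : Literature.Probability.RandomPlanarGeometry.DobrushinDomain) (ψ : Literature.Probability.RandomPlanarGeometry.ConformalEquiv UpperHalfPlane.upperHalfPlaneSet E.carrier), E.IsChordalUniformizing ψ → ∀ (U : NNReal → ℝ) (ζ ρ : NNReal → ℂ), Continuous U → Literature.Probability.RandomPlanarGeometry.Loewner.IsGeneratedByCurve U ζ → Literature.Probability.RandomPlanarGeometry.Loewner.IsSimpleTrace ζ → Continuous ρ → (∀ u, 0 ≤ (ρ u).im) → ∀ (T : NNReal) (ε μ μ₀ w θ c₀ ρ₁ m₁ h₀ d' dS lam r₁ Rout α₀ dB : ℝ), 0 < ε → 5 * ε < μ → 0 < w → w < θ / 2 → 8 * θ < c₀ → 5 * θ + w ≤ 1 → 0 ≤ ρ₁ → 0 < r₁ → 5 * (ρ₁ + Real.sqrt (θ + 4 * w)) ≤ r₁ → 0 < Rout → Rout ≤ m₁ → Rout ≤ h₀ → 0 ≤ dS → lam + 5 * ε + 2 * dS < μ₀ → 3 * ε < dB → 2 * dS + 2 * ε < dB → 0 < α₀ → (∀ t : NNReal, (t : ℝ) ≤ T + 1 → Metric.hausdorffDist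 (ψ.boundaryExtension '' (ζ '' Set.Icc 0 t)) ((fun u => ψ.boundaryExtension (ρ u)) '' Set.Icc 0 t) ≤ ε) → (∀ s t : NNReal, (s : ℝ) ≤ T + 1 → (t : ℝ) ≤ T + 1 → w ≤ |(s : ℝ) - t| → μ ≤ dist (ψ.boundaryExtension (ρ s)) (ψ.boundaryExtension (ρ t))) → (∀ s t : NNReal, (s : ℝ) ≤ T + 1 → (t : ℝ) ≤ T + 1 → c₀ / 4 ≤ |(s : ℝ) - t| → μ₀ ≤ dist (ψ.boundaryExtension (ρ s)) (ψ.boundaryExtension (ρ t))) → (∀ s s' : NNReal, (s : ℝ) ≤ T + 1 → (s' : ℝ) ≤ T + 1 → |(s : ℝ) - s'| ≤ θ + 4 * w → |U s - U s'| ≤ ρ₁) → (∀ t₁ : NNReal, (t₁ : ℝ) ≤ T → ∃ u : NNReal, (t₁ : ℝ) + 2 * θ ≤ u ∧ (u : ℝ) ≤ t₁ + 4 * θ ∧ ρ u ∈ Literature.Probability.RandomPlanarGeometry.Loewner.domain U t₁ ∧ m₁ ≤ ‖Literature.Probability.RandomPlanarGeometry.Loewner.map U t₁ (ρ u) - U t₁‖)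 → (∀ t₁ : NNReal, (t₁ : ℝ) ≤ T → ∀ e ∈ E.carrier, d' ≤ Metric.infDist e ((fun u => ψ.boundaryExtension (ρ u)) '' Set.Icc 0 (T + 1) ∪ frontier E.carrier) → ψ.symm e ∈ Literature.Probability.RandomPlanarGeometry.Loewner.domain U t₁ ∧ h₀ ≤ (Literature.Probability.RandomPlanarGeometry.Loewner.map U t₁ (ψ.symm e)).im) → (∀ u : NNReal, α₀ / 2 ≤ (u : ℝ) → (u : ℝ) ≤ T + 1 → dB ≤ Metric.infDist (ψ.boundaryExtension (ρ u)) (frontier E.carrier)) → (∀ t₁ : NNReal, (t₁ : ℝ) ≤ T → ∃ C P Q : Set ℂ, (∀ p ∈ C, ∀ q ∈ C, dist p q ≤ lam) ∧ Disjoint P Q ∧ Disjoint P C ∧ Disjoint Q C ∧ P ∪ Q ∪ C = ψ '' (Literature.Probability.RandomPlanarGeometry.Loewner.domain U t₁) ∧ (∀ S : Set ℂ, IsPreconnected S → S ⊆ P ∪ Q → S ⊆ P ∨ S ⊆ Q) ∧ (∀ y : ℂ, 0 < y.im → dist y (U t₁) ≤ r₁ → ψ (Literature.Probability.RandomPlanarGeometry.Loewner.loewnerInv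 U t₁ y) ∈ P) ∧ (∀ y : ℂ, 0 < y.im → Rout ≤ dist y (U t₁) → ψ (Literature.Probability.RandomPlanarGeometry.Loewner.loewnerInv U t₁ y) ∈ Q)) → ∀ t : NNReal, (t : ℝ) ≤ T → ∀ ut : NNReal, α₀ ≤ (ut : ℝ) → (ut : ℝ) ≤ T + 1 → dist (ψ.boundaryExtension (ζ t)) (ψ.boundaryExtension (ρ ut)) ≤ 2 * ε → (∃ s : NNReal, s ≤ t ∧ ∃ us : NNReal, (us : ℝ) ≤ T + 1 ∧ dist (ψ.boundaryExtension (ζ s)) (ψ.boundaryExtension (ρ us)) ≤ 2 * ε ∧ (ut : ℝ) + c₀ ≤ us) → ∀ e ∈ E.carrier, dist e (ψ.boundaryExtension (ζ t)) ≤ 2 * dS → d' ≤ Metric.infDist e ((fun u => ψ.boundaryExtension (ρ u)) '' Set.Icc 0 (T + 1) ∪ frontier E.carrier) → ∃ s : NNReal, s < t ∧ ψ.boundaryExtension (ζ s) ∈ segment ℝ (ψ.boundaryExtension (ζ t)) e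

/-- `Compat` — coarse anti-monotonicity of the two level structures (purely metric): a simple curve `X` whose initial
segments are `ε`-shadowed by `r` and whose final segments are `ε'`-shadowed by `r'` (with moduli, a no-escape clause at
`b` and the window balls) has: lower `r`-level by `2c₀` ⇒ higher `r'`-level by `c₁`. -/
def Compat : Prop :=
  ∀ (X : Literature.Probability.RandomPlanarGeometry.Curve ℂ), Function.Injective X → ∀ (Xf Xb r r' : NNReal → ℂ) (T T' : NNReal) (utop : unitInterval) (b : ℂ) (ε ε' μ ν μ'' μ₀ w w'' c₀ c₁ Ttop rb rb' : ℝ), Continuous Xf → Continuous Xb → Continuous r → Continuous r' → 0 < ε → 0 < ε' → 0 < w → 0 < w'' → w'' ≤ c₁ → 0 < c₀ → 3 * w ≤ c₀ → 3 * ε + 3 * ε' < μ → 3 * ε + 3 * ε' + ν < μ'' → 0 < rb → rb < rb' → Ttop + 3 * w ≤ T + 1 → (∀ t : NNReal, (t : ℝ) ≤ T + 1 → ∃ u : unitInterval, X u = Xf t ∧ X '' Set.Icc 0 u = Xf '' Set.Icc 0 t) → (∀ t : NNReal, (t : ℝ) ≤ T' + 1 → ∃ u : unitInterval, X u = Xb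 t ∧ X '' Set.Icc u 1 = Xb '' Set.Icc 0 t) → X utop = Xf (T + 1) → X '' Set.Icc 0 utop = Xf '' Set.Icc 0 (T + 1) → (∀ t : NNReal, (t : ℝ) ≤ T + 1 → Metric.hausdorffDist (Xf '' Set.Icc 0 t) (r '' Set.Icc 0 t) ≤ ε) → (∀ t : NNReal, (t : ℝ) ≤ T' + 1 → Metric.hausdorffDist (Xb '' Set.Icc 0 t) (r' '' Set.Icc 0 t) ≤ ε') → (∀ s t : NNReal, (s : ℝ) ≤ T + 1 → (t : ℝ) ≤ T + 1 → w ≤ |(s : ℝ) - t| → μ ≤ dist (r s) (r t)) → (∀ s t : NNReal, (s : ℝ) ≤ T + 1 → (t : ℝ) ≤ T + 1 → |(s : ℝ) - t| ≤ 2 * w → dist (r s) (r t) ≤ ν) → (∀ s t : NNReal, (s : ℝ) ≤ T + 1 → (t : ℝ) ≤ T + 1 → c₀ / 4 ≤ |(s : ℝ) - t| → μ₀ ≤ dist (r s) (r t)) → (∀ s t : NNReal, (s : ℝ) ≤ T' + 1 → (t : ℝ) ≤ T' + 1 → w'' ≤ |(s : ℝ) - t| → μ'' ≤ dist (r' s)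 (r' t)) → (∀ s t : NNReal, (s : ℝ) ≤ T' + 1 → (t : ℝ) ≤ T' + 1 → |(s : ℝ) - t| ≤ c₁ → dist (r' s) (r' t) < μ₀ - 4 * ε - 4 * ε') → (∀ u : NNReal, (u : ℝ) ≤ Ttop + 2 * w → rb' + 2 * ε + 3 * ε' < dist (r u) b) → dist (r (T + 1)) b + ε ≤ rb → (∀ v : unitInterval, utop < v → dist (X v) b < rb) → (∀ v v' : unitInterval, v ≤ v' → dist (X v) b ≤ rb → dist (X v') b < rb') → ∀ v₁ v₂ : unitInterval, ∀ u₁ u₂ : NNReal, (u₂ : ℝ) ≤ Ttop → dist (X v₁) (r u₁) ≤ 2 * ε → dist (X v₂) (r u₂) ≤ 2 * ε → (u₁ : ℝ) + 2 * c₀ ≤ u₂ → ∀ u₁' u₂' : NNReal, (u₁' : ℝ) ≤ T' + 1 → (u₂' : ℝ) ≤ T' + 1 → dist (X v₁) (r' u₁') ≤ 2 * ε' → dist (X v₂) (r' u₂') ≤ 2 * ε' → (u₂' : ℝ) + c₁ ≤ u₁'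

/-- `ReturnsDie` — ORDER: returns die in law under H1–H7 (proof = the lead's wrapper around `Gate`, `Flank`, `Compat`
and the landed statements; kept hypothesis-free because of the 4000-character cap on stub signatures):
`∀ ℓ η > 0 ∃ κ > 0`, eventually `P δ {∃ s < u < t, ℓ ≤ |X s - X u| ∧ |X s - X t| ≤ κ} ≤ η`. -/
def ReturnsDie : Prop :=
  ∀ (D : Literature.Probability.RandomPlanarGeometry.DobrushinDomain) (φ : Literature.Probability.RandomPlanarGeometry.ConformalEquiv UpperHalfPlane.upperHalfPlaneSet D.carrier), D.IsChordalUniformizing φ → ∀ (φ' : Literature.Probability.RandomPlanarGeometry.ConformalEquiv UpperHalfPlane.upperHalfPlaneSet D.swap.carrier), D.swap.IsChordalUniformizing φ' → ∀ (Ω : ℝ → Type) [∀ δ, MeasurableSpace (Ω δ)] (X : (δ : ℝ) → Ω δ → Literature.Probability.RandomPlanarGeometry.Curve ℂ) (P : (δ : ℝ) → MeasureTheory.Measure (Ω δ)), (∀ᶠ δ in (nhdsWithin (0:ℝ) (Set.Ioi 0)), MeasureTheory.IsProbabilityMeasure (P δ)) → (∀ᶠ δ in (nhdsWithin (0:ℝ)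 (Set.Ioi 0)), AEMeasurable (fun ω => Literature.Probability.RandomPlanarGeometry.CurveClass.mk (X δ ω)) (P δ)) → (∀ᶠ δ in (nhdsWithin (0:ℝ) (Set.Ioi 0)), ∀ ω : Ω δ, Function.Injective (X δ ω) ∧ (X δ ω).source = D.pt 0 ∧ (X δ ω).target = D.pt 1 ∧ ∀ t : unitInterval, X δ ω t = D.pt 0 ∨ X δ ω t = D.pt 1 ∨ X δ ω t ∈ D.carrier) → (∀ T : NNReal, Literature.Probability.RandomPlanarGeometry.TendstoLaw (fun δ (ω : Ω δ) => ((⟨Literature.Probability.RandomPlanarGeometry.drivingFunction (φ) (Literature.Probability.RandomPlanarGeometry.CurveClass.mk (X δ ω)), Literature.Probability.RandomPlanarGeometry.continuous_drivingFunction (φ) (Literature.Probability.RandomPlanarGeometry.CurveClass.mk (X δ ω))⟩ : C(NNReal, ℝ)).restrict (Set.Icc (0:NNReal) T))) P (fun ω : NNReal → ℝ => ((⟨Literature.Probability.RandomPlanarGeometry.sleDriving ((8:NNReal)/3) ω, Literature.Probability.RandomPlanarGeometry.continuous_sleDriving ((8:NNReal)/3) ω⟩ : C(NNReal, ℝ)).restrict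 (Set.Icc (0:NNReal) T))) Literature.Probability.Process.preWienerMeasure) → (∀ T : NNReal, Literature.Probability.RandomPlanarGeometry.TendstoLaw (fun δ (ω : Ω δ) => ((⟨Literature.Probability.RandomPlanarGeometry.drivingFunction (φ') ((Literature.Probability.RandomPlanarGeometry.CurveClass.mk (X δ ω)).reverse), Literature.Probability.RandomPlanarGeometry.continuous_drivingFunction (φ') ((Literature.Probability.RandomPlanarGeometry.CurveClass.mk (X δ ω)).reverse)⟩ : C(NNReal, ℝ)).restrict (Set.Icc (0:NNReal) T))) P (fun ω : NNReal → ℝ => ((⟨Literature.Probability.RandomPlanarGeometry.sleDriving ((8:NNReal)/3) ω, Literature.Probability.RandomPlanarGeometry.continuous_sleDriving ((8:NNReal)/3) ω⟩ : C(NNReal, ℝ)).restrict (Set.Icc (0:NNReal) T))) Literature.Probability.Process.preWienerMeasure) → (∀ ε : ℝ, 0 < ε → ∀ η : ℝ, 0 < η → ∃ r : ℝ, 0 < r ∧ ∀ᶠ δ in (nhdsWithin (0:ℝ) (Set.Ioi 0)), P δ {ω | ∃ s t : unitInterval, s < t ∧ ε ≤ dist (X δ ω s) (D.pt 0) ∧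 dist (X δ ω t) (D.pt 0) ≤ r} ≤ ENNReal.ofReal η) → (∀ ε : ℝ, 0 < ε → ∀ η : ℝ, 0 < η → ∃ r : ℝ, 0 < r ∧ ∀ᶠ δ in (nhdsWithin (0:ℝ) (Set.Ioi 0)), P δ {ω | ∃ s t : unitInterval, s < t ∧ dist (X δ ω s) (D.pt 1) ≤ r ∧ ε ≤ dist (X δ ω t) (D.pt 1)} ≤ ENNReal.ofReal η) → ∀ ℓ : ℝ, 0 < ℓ → ∀ η : ℝ, 0 < η → ∃ κ : ℝ, 0 < κ ∧ ∀ᶠ δ in (nhdsWithin (0:ℝ) (Set.Ioi 0)), P δ {ω | ∃ s u t : unitInterval, s < u ∧ u < t ∧ ℓ ≤ dist (X δ ω s) (X δ ω u) ∧ dist (X δ ω s) (X δ ω t) ≤ κ} ≤ ENNReal.ofReal η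

/-- `UpgradeOfReturns` — the soft curve upgrade with returns (LANDED). -/
def UpgradeOfReturns : Prop :=
  ∀ (D : Literature.Probability.RandomPlanarGeometry.DobrushinDomain) (Ω : ℝ → Type) [∀ δ, MeasurableSpace (Ω δ)] (X : (δ : ℝ) → Ω δ → Literature.Probability.RandomPlanarGeometry.Curve ℂ) (P : (δ : ℝ) → MeasureTheory.Measure (Ω δ)) (Γ : (NNReal → ℝ) → Literature.Probability.RandomPlanarGeometry.CurveClass ℂ), Literature.Probability.RandomPlanarGeometry.IsSLECurve ((8:NNReal)/3) D Γ → (∀ᶠ δ in (nhdsWithin (0:ℝ) (Set.Ioi 0)), AEMeasurable (fun ω => Literature.Probability.RandomPlanarGeometry.CurveClass.mk (X δ ω)) (P δ)) → Literature.Probability.RandomPlanarGeometry.TendstoLaw (fun δ (ω : Ω δ) => (⟨⟨(Literature.Probability.RandomPlanarGeometry.CurveClass.mk (X δ ω)).range, (Literature.Probability.RandomPlanarGeometry.CurveClass.mk (X δ ω)).isCompact_range⟩, (Literature.Probability.RandomPlanarGeometry.CurveClass.mk (X δ ω)).range_nonempty⟩ : TopologicalSpace.NonemptyCompacts ℂ))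 P (fun ω => (⟨⟨(Γ ω).range, (Γ ω).isCompact_range⟩, (Γ ω).range_nonempty⟩ : TopologicalSpace.NonemptyCompacts ℂ)) Literature.Probability.Process.preWienerMeasure → (∀ᶠ δ in (nhdsWithin (0:ℝ) (Set.Ioi 0)), ∀ ω : Ω δ, (X δ ω).source = D.pt 0 ∧ (X δ ω).target = D.pt 1) → (∀ ℓ : ℝ, 0 < ℓ → ∀ η : ℝ, 0 < η → ∃ κ : ℝ, 0 < κ ∧ ∀ᶠ δ in (nhdsWithin (0:ℝ) (Set.Ioi 0)), P δ {ω | ∃ s u t : unitInterval, s < u ∧ u < t ∧ ℓ ≤ dist (X δ ω s) (X δ ω u) ∧ dist (X δ ω s) (X δ ω t) ≤ κ} ≤ ENNReal.ofReal η) → Literature.Probability.RandomPlanarGeometry.ConvergesInLawToSLE ((8:NNReal)/3) D (fun δ (ω : Ω δ) => Literature.Probability.RandomPlanarGeometry.CurveClass.mk (X δ ω)) P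

/-! ### The stubs (tree vocabulary only; each lands verbatim as
`Theorems/SAWReversalUpgradePathUpgradeR<Stub>.lean --supports stmt-CriticalPhenomena-18055`) -/

/-- `stub_hullHausdorff` (= `HullHausdorff`; deterministic, M/L). Upper bound DONE
(`Lines/bidir_windows_HullUpper.lean`: KS Lemma 5.4 `Loewner.eventually_disjoint_hull_of_tendstoUniformlyOn_driving`
on the compact set `ε`-off the arc inside the a-priori disc); lower bound: `closedHull` is connected to the
real line (`Loewner.isConnected_closedHull_union_im_nonpos`), a Hausdorff cluster value inside `γ[0,T]` missing
an interior sub-arc is a proper initial arc, contradicting `hcap = 2T` (`Loewner.hcap_hull_eq`,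
`tendsto_hcap_of_thickening`). -/
theorem stub_hullHausdorff : ∀ (W : ℕ → NNReal → ℝ) (V : NNReal → ℝ) (γ : NNReal → ℂ) (T : NNReal), 0 < T → (∀ n, Continuous (W n)) → Continuous V → Literature.Probability.RandomPlanarGeometry.Loewner.IsGeneratedByCurve V γ → Literature.Probability.RandomPlanarGeometry.Loewner.IsSimpleTrace γ → (∀ x : ℝ, x ≠ V 0 → (T : WithTop NNReal) < Literature.Probability.RandomPlanarGeometry.Loewner.swallowingTime V (x : ℂ)) → TendstoUniformlyOn W V Filter.atTop (Set.Icc 0 T) → Filter.Tendsto (fun n => Metric.hausdorffDist (closure (Literature.Probability.RandomPlanarGeometry.Loewner.hull (W n) T)) (γ '' Set.Icc 0 T)) Filter.atTop (nhds 0) :=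
  -- LANDED: p161175 (Theorems/SAWReversalUpgradePathUpgradeRHullHausdorff.lean)
  Summit.CriticalPhenomena.SAWScalingLimit.Theorems.stub_hullHausdorff

/-- `stub_lawClosed` (= `LawClosed`; generic measure theory, M). `→`: normalise the eventually-bad
indices to get `ProbabilityMeasure`-valued convergence (`tendstoLaw_iff_tendstoInDistribution` pattern),
`ProbabilityMeasure.limsup_measure_closed_le_of_tendsto`, then `limsup ≤ c < ⊤ ⇒ ∀ β > 0, ∀ᶠ, ≤ c + β`.
`←`: `limsup ≤ P'(Z⁻¹F) + β` for all `β` ⇒ `tendsto_of_forall_isClosed_limsup_le`, then integrals of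
bounded continuous functions (`ProbabilityMeasure.tendsto_iff_forall_integral_tendsto`, `integral_map`,
`Tendsto.congr'`). -/
theorem stub_lawClosed : ∀ (S : Type) [PseudoEMetricSpace S] [MeasurableSpace S] [BorelSpace S] (Ωδ : ℝ → Type) [∀ δ, MeasurableSpace (Ωδ δ)] (Ω' : Type) [MeasurableSpace Ω'] (Y : (δ : ℝ) → Ωδ δ → S) (P : (δ : ℝ) → MeasureTheory.Measure (Ωδ δ)) (Z : Ω' → S) (P' : MeasureTheory.Measure Ω'), MeasureTheory.IsProbabilityMeasure P' → (∀ᶠ δ in (nhdsWithin (0:ℝ) (Set.Ioi 0)), MeasureTheory.IsProbabilityMeasure (P δ)) → (∀ᶠ δ in (nhdsWithin (0:ℝ) (Set.Ioi 0)), AEMeasurable (Y δ) (P δ)) → AEMeasurable Z P' → (Literature.Probability.RandomPlanarGeometry.TendstoLaw Y P Z P' ↔ ∀ F : Set S, IsClosed F → ∀ β : ENNReal, 0 < β → ∀ᶠ δ in (nhdsWithin (0:ℝ) (Set.Ioi 0)), P δ (Y δ ⁻¹' F) ≤ P' (Z ⁻¹' F) + β) :=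
  -- LANDED: p160537 (Theorems/SAWReversalUpgradePathUpgradeRLawClosed.lean)
  Summit.CriticalPhenomena.SAWScalingLimit.Theorems.stub_lawClosed

/-- `stub_sleHullPackage` (= `HullHausdorff → SLEHullPackage`; SLE side, M). A.e. inputs (all PROVED in
the tree): `hasSLETrace_eightThirds` + `ae_isGeneratedByCurve_sleTrace`, `ae_isSimpleTrace_sleTrace_of_le_four_holds`,
`sle_swallowingTime_ofReal_eq_top_holds` (x > 0) + `Loewner.swallowingTime_neg_ofReal` /
`identDistrib_sleDriving_neg` (x < 0), `IsGeneratedByCurve.hull_eq_image`; continuity from `HullHausdorff` by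
contradiction along `ρ = 1/n` and uniform continuity of `φ.boundaryExtension` on
`closedBall 0 R ∩ {im ≥ 0}` (`continuousOn_boundaryExtension_im_nonneg`, `Loewner.hull_subset_closedBall_driving`);
transience `tendsto_norm_sleTrace_atTop_of_ne_eight` + `IsChordalUniformizing.tendsto_boundaryExtension_cocompact`. -/
theorem stub_sleHullPackage : (∀ (W : ℕ → NNReal → ℝ) (V : NNReal → ℝ) (γ : NNReal → ℂ) (T : NNReal), 0 < T → (∀ n, Continuous (W n)) → Continuous V → Literature.Probability.RandomPlanarGeometry.Loewner.IsGeneratedByCurve V γ → Literature.Probability.RandomPlanarGeometry.Loewner.IsSimpleTrace γ → (∀ x : ℝ, x ≠ V 0 → (T : WithTop NNReal) < Literature.Probability.RandomPlanarGeometry.Loewner.swallowingTime V (x : ℂ)) → TendstoUniformlyOn W V Filter.atTop (Set.Icc 0 T) → Filter.Tendsto (fun n => Metric.hausdorffDist (closure (Literature.Probability.RandomPlanarGeometry.Loewner.hull (W n) T)) (γ '' Set.Icc 0 T)) Filter.atTop (nhds 0)) → ∀ (D : Literature.Probability.RandomPlanarGeometry.DobrushinDomain) (φ : Literature.Probability.RandomPlanarGeometry.ConformalEquiv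 UpperHalfPlane.upperHalfPlaneSet D.carrier), D.IsChordalUniformizing φ → (∀ T : NNReal, 0 < T → ∀ᵐ ω ∂Literature.Probability.Process.preWienerMeasure, closure (Literature.Probability.RandomPlanarGeometry.Loewner.hull (Literature.Probability.RandomPlanarGeometry.sleDriving ((8:NNReal)/3) ω) T) = Literature.Probability.RandomPlanarGeometry.sleTrace ((8:NNReal)/3) ω '' Set.Icc 0 T ∧ ∀ ε : ℝ, 0 < ε → ∃ ρ : ℝ, 0 < ρ ∧ ∀ W' : NNReal → ℝ, Continuous W' → (∀ s : NNReal, s ≤ T → |W' s - Literature.Probability.RandomPlanarGeometry.sleDriving ((8:NNReal)/3) ω s| ≤ ρ) → Metric.hausdorffDist (φ.boundaryExtension '' closure (Literature.Probability.RandomPlanarGeometry.Loewner.hull W' T)) (φ.boundaryExtension '' closure (Literature.Probability.RandomPlanarGeometry.Loewner.hull (Literature.Probability.RandomPlanarGeometry.sleDriving ((8:NNReal)/3) ω) T)) ≤ ε) ∧ (∀ᵐ ω ∂Literature.Probability.Process.preWienerMeasure, ∀ ε : ℝ, 0 < ε → ∃ T₀ : NNReal, ∀ t : NNReal, T₀ ≤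 t → dist (φ.boundaryExtension (Literature.Probability.RandomPlanarGeometry.sleTrace ((8:NNReal)/3) ω t)) (D.pt 1) ≤ ε) :=
  -- LANDED: p160796 (Theorems/SAWReversalUpgradePathUpgradeRSLEHullPackage.lean)
  Summit.CriticalPhenomena.SAWScalingLimit.Theorems.stub_sleHullPackage

/-- `stub_latticeDictionary` (= `LatticeDictionary`; deterministic, M). From `IsLoewnerDescribed`:
`mk X = mk c'` with `c'` the compactified `φ̄`-image of `γ = trace W` (`IsLoewnerDescribed.exists_eq_mk_trace`);
`X` injective ⇒ `c' = X ∘ m` with `m : I → I` continuous monotone onto (`Curve.exists_dist_reparam_lt` +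
compactness); a plateau of `m` would freeze `t ↦ hull W t` on an interval, contradicting `Loewner.hcap_hull_eq`;
hence `γ` injective, `IsSimpleTrace`, `closure (hull W T) = γ '' Icc 0 T` (`hull_eq_image`), and `u₀ := m (ray⁻¹ T)`.
Capacity clause: `φ̄ ⁻¹' (closure D ∖ ball b r) ∩ {im ≥ 0}` is bounded
(`IsChordalUniformizing.tendsto_boundaryExtension_cocompact`), and `hull W T ⊆ closedBall x R ⇒ 2T ≤ 288 R²`
(`Loewner.two_mul_le_of_hull_subset_closedBall`). -/
theorem stub_latticeDictionary : ∀ (D : Literature.Probability.RandomPlanarGeometry.DobrushinDomain) (φ : Literature.Probability.RandomPlanarGeometry.ConformalEquiv UpperHalfPlane.upperHalfPlaneSet D.carrier), D.IsChordalUniformizing φ → (∀ (X : Literature.Probability.RandomPlanarGeometry.Curve ℂ) (W : NNReal → ℝ), Function.Injective X → X.source = D.pt 0 → X.target = D.pt 1 → (∀ t : unitInterval, X t = D.pt 0 ∨ X t = D.pt 1 ∨ X t ∈ D.carrier) → Literature.Probability.RandomPlanarGeometry.IsLoewnerDescribed φ (Literature.Probability.RandomPlanarGeometry.CurveClass.mk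 X) W → Literature.Probability.RandomPlanarGeometry.Loewner.IsSimpleTrace (Literature.Probability.RandomPlanarGeometry.Loewner.trace W) ∧ (∀ T : NNReal, 0 < T → closure (Literature.Probability.RandomPlanarGeometry.Loewner.hull W T) = Literature.Probability.RandomPlanarGeometry.Loewner.trace W '' Set.Icc 0 T) ∧ (∀ T : NNReal, ∃ u₀ : unitInterval, X u₀ = φ.boundaryExtension (Literature.Probability.RandomPlanarGeometry.Loewner.trace W T) ∧ X '' Set.Icc 0 u₀ = φ.boundaryExtension '' (Literature.Probability.RandomPlanarGeometry.Loewner.trace W '' Set.Icc 0 T))) ∧ (∀ r : ℝ, 0 < r → ∃ T₀ : NNReal, ∀ (W : NNReal → ℝ) (γ : NNReal → ℂ), Continuous W → Literature.Probability.RandomPlanarGeometry.Loewner.IsGeneratedByCurve W γ → ∀ T : NNReal, T₀ ≤ T → ∃ t : NNReal, t ≤ T ∧ dist (φ.boundaryExtension (γ t)) (D.pt 1) < r) :=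
  -- LANDED: p160945 (Theorems/SAWReversalUpgradePathUpgradeRLatticeDictionary.lean)
  Summit.CriticalPhenomena.SAWScalingLimit.Theorems.stub_latticeDictionary

/-- `stub_rangeBound` (= `RangeBound`; M/L). With `Γ` the SLE_(8/3) curve through `φ`
(`exists_isSLECurve_eightThirds`-style transport with the a.e. description by `sleDriving`), `ε, T` chosen from
`β`: `{range X ∈ F} ⊆ {W^δ|[0,T] ∈ A} ∪ {tail ⊄ B(b,ε)} ∪ {mk X not describable}` where
`A = {w | Φ_T w ∈ cthickening ε F}`, `Φ_T w = φ̄ '' closure (hull ŵ T) ∪ ...`; `LawClosed (→)` for H4 on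
`closure A` and on `{0}`; `closure A ⊆ A ∪ Disc(Φ_T)` and `P'(Disc) = 0` (`SLEHullPackage`); `P'(B_T|[0,T] = 0) = 0`;
lattice tail by `LatticeDictionary` + H7; SLE tail by transience; `tendsto_measure_cthickening_of_isClosed`. -/
theorem stub_rangeBound : ∀ (D : Literature.Probability.RandomPlanarGeometry.DobrushinDomain) (φ : Literature.Probability.RandomPlanarGeometry.ConformalEquiv UpperHalfPlane.upperHalfPlaneSet D.carrier), D.IsChordalUniformizing φ → ∀ (Ω : ℝ → Type) [∀ δ, MeasurableSpace (Ω δ)] (X : (δ : ℝ) → Ω δ → Literature.Probability.RandomPlanarGeometry.Curve ℂ) (P : (δ : ℝ) → MeasureTheory.Measure (Ω δ)), (∀ᶠ δ in (nhdsWithin (0:ℝ) (Set.Ioi 0)), MeasureTheory.IsProbabilityMeasure (P δ)) → (∀ᶠ δ in (nhdsWithin (0:ℝ) (Set.Ioi 0)), AEMeasurable (fun ω => Literature.Probability.RandomPlanarGeometry.CurveClass.mk (X δ ω)) (P δ)) → (∀ᶠ δ in (nhdsWithin (0:ℝ) (Set.Ioi 0)), ∀ ω : Ω δ, Function.Injective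 (X δ ω) ∧ (X δ ω).source = D.pt 0 ∧ (X δ ω).target = D.pt 1 ∧ ∀ t : unitInterval, X δ ω t = D.pt 0 ∨ X δ ω t = D.pt 1 ∨ X δ ω t ∈ D.carrier) → (∀ T : NNReal, Literature.Probability.RandomPlanarGeometry.TendstoLaw (fun δ (ω : Ω δ) => ((⟨Literature.Probability.RandomPlanarGeometry.drivingFunction (φ) (Literature.Probability.RandomPlanarGeometry.CurveClass.mk (X δ ω)), Literature.Probability.RandomPlanarGeometry.continuous_drivingFunction (φ) (Literature.Probability.RandomPlanarGeometry.CurveClass.mk (X δ ω))⟩ : C(NNReal, ℝ)).restrict (Set.Icc (0:NNReal) T))) P (fun ω : NNReal → ℝ => ((⟨Literature.Probability.RandomPlanarGeometry.sleDriving ((8:NNReal)/3) ω, Literature.Probability.RandomPlanarGeometry.continuous_sleDriving ((8:NNReal)/3) ω⟩ : C(NNReal, ℝ)).restrict (Set.Icc (0:NNReal) T))) Literature.Probability.Process.preWienerMeasure) → (∀ ε : ℝ, 0 < ε → ∀ η : ℝ, 0 < η → ∃ r : ℝ, 0 < r ∧ ∀ᶠ δ in (nhdsWithin (0:ℝ)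 (Set.Ioi 0)), P δ {ω | ∃ s t : unitInterval, s < t ∧ dist (X δ ω s) (D.pt 1) ≤ r ∧ ε ≤ dist (X δ ω t) (D.pt 1)} ≤ ENNReal.ofReal η) → ∃ Γ : (NNReal → ℝ) → Literature.Probability.RandomPlanarGeometry.CurveClass ℂ, Literature.Probability.RandomPlanarGeometry.IsSLECurve ((8:NNReal)/3) D Γ ∧ ∀ F : Set (TopologicalSpace.NonemptyCompacts ℂ), IsClosed F → ∀ β : ENNReal, 0 < β → ∀ᶠ δ in (nhdsWithin (0:ℝ) (Set.Ioi 0)), P δ {ω | (⟨⟨(Literature.Probability.RandomPlanarGeometry.CurveClass.mk (X δ ω)).range, (Literature.Probability.RandomPlanarGeometry.CurveClass.mk (X δ ω)).isCompact_range⟩, (Literature.Probability.RandomPlanarGeometry.CurveClass.mk (X δ ω)).range_nonempty⟩ : TopologicalSpace.NonemptyCompacts ℂ) ∈ F} ≤ Literature.Probability.Process.preWienerMeasure {ω | (⟨⟨(Γ ω).range, (Γ ω).isCompact_range⟩, (Γ ω).range_nonempty⟩ : TopologicalSpace.NonemptyCompacts ℂ) ∈ F} + β :=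
  -- LANDED: p162480 (Theorems/SAWReversalUpgradePathUpgradeRRangeBound.lean; aux p161678)
  Summit.CriticalPhenomena.SAWScalingLimit.Theorems.stub_rangeBound

/-- `stub_gate` (= `Gate`; conformal geometry, M; LANDED p162698). Cayley map `z ↦ U t₁ + R_out · i (1 - z)/(1 + z)` from `𝔻`,
`f := ψ ∘ loewnerInv U t₁ ∘ Cayley` univalent with image in `ball c M`; tree Wolff lemma
`Literature.Analysis.Complex.LengthArea…exists_radius_forall_short_crosscut_of_subset_ball` at `ζ = 1` with `ε := λ/2`;
`P, Q, C :=` images of `𝔻 ∩ ball 1 r`, `𝔻 ∖ closedBall 1 r`, `𝔻 ∩ sphere 1 r`; preconnected sets pulled back by the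
homeomorphism. -/
theorem stub_gate : ∀ (M lam Rout : ℝ), 0 < M → 0 < lam → 0 < Rout → ∃ r₁ : ℝ, 0 < r₁ ∧ ∀ (E : Literature.Probability.RandomPlanarGeometry.DobrushinDomain) (ψ : Literature.Probability.RandomPlanarGeometry.ConformalEquiv UpperHalfPlane.upperHalfPlaneSet E.carrier) (c : ℂ), E.carrier ⊆ Metric.ball c M → ∀ (U : NNReal → ℝ), Continuous U → ∀ t₁ : NNReal, ∃ C P Q : Set ℂ, (∀ p ∈ C, ∀ q ∈ C, dist p q ≤ lam) ∧ Disjoint P Q ∧ Disjoint P C ∧ Disjoint Q C ∧ P ∪ Q ∪ C = ψ '' (Literature.Probability.RandomPlanarGeometry.Loewner.domain U t₁) ∧ (∀ S : Set ℂ, IsPreconnected S → S ⊆ P ∪ Q → S ⊆ P ∨ S ⊆ Q) ∧ (∀ y : ℂ, 0 < y.im → dist y (U t₁) ≤ r₁ → ψ (Literature.Probability.RandomPlanarGeometry.Loewner.loewnerInv U t₁ y) ∈ P) ∧ (∀ y : ℂ, 0 < y.im → Rout ≤ dist y (U t₁) → ψ (Literature.Probability.RandomPlanarGeometry.Loewner.loewnerInv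 U t₁ y) ∈ Q) :=
  -- LANDED: p162698 (Theorems/SAWReversalUpgradePathUpgradeRGate.lean)
  Summit.CriticalPhenomena.SAWScalingLimit.Theorems.stub_gate

/-- `stub_flank` (= `Flank`; deterministic, L; LANDED p162909). Proof in the module docstring of the lead's design (record time `t₁` =
argmax level, `t₁ ≤ M < t₁ + w`; overshoot time `t₂ ≤ t₁ + θ + 3w`; `SmallIncrement`
(`hull_shift_subset_closedBall_of_osc` + `image_map_hull_add_sdiff`) puts `ψ̄ ζ (t₁, t₂] ⊆ P`; the connected set
`G = ⋃_{u ∈ [M+θ/2, M+5θ]} ball (r u) 3ε` misses the past, meets `P` (at `t₂`) and `Q` (gate point), hence meets `C`, so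
`C` sits near levels `≥ M + θ/2`; the segment towards `e` misses `C`, lies in `E`, joins `P` to `Q`, so leaves
`ψ (domain U t₁)`, i.e. meets `ψ (hull U t₁) = ψ̄ ζ (0, t₁]`). -/
theorem stub_flank : ∀ (E : Literature.Probability.RandomPlanarGeometry.DobrushinDomain) (ψ : Literature.Probability.RandomPlanarGeometry.ConformalEquiv UpperHalfPlane.upperHalfPlaneSet E.carrier), E.IsChordalUniformizing ψ → ∀ (U : NNReal → ℝ) (ζ ρ : NNReal → ℂ), Continuous U → Literature.Probability.RandomPlanarGeometry.Loewner.IsGeneratedByCurve U ζ → Literature.Probability.RandomPlanarGeometry.Loewner.IsSimpleTrace ζ → Continuous ρ → (∀ u, 0 ≤ (ρ u).im) → ∀ (T : NNReal) (ε μ μ₀ w θ c₀ ρ₁ m₁ h₀ d' dS lam r₁ Rout α₀ dB : ℝ), 0 < ε → 5 * ε < μ → 0 < w → w < θ / 2 → 8 * θ < c₀ → 5 * θ + w ≤ 1 → 0 ≤ ρ₁ → 0 < r₁ → 5 * (ρ₁ + Real.sqrt (θ + 4 * w)) ≤ r₁ → 0 < Rout → Rout ≤ m₁ → Rout ≤ h₀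 → 0 ≤ dS → lam + 5 * ε + 2 * dS < μ₀ → 3 * ε < dB → 2 * dS + 2 * ε < dB → 0 < α₀ → (∀ t : NNReal, (t : ℝ) ≤ T + 1 → Metric.hausdorffDist (ψ.boundaryExtension '' (ζ '' Set.Icc 0 t)) ((fun u => ψ.boundaryExtension (ρ u)) '' Set.Icc 0 t) ≤ ε) → (∀ s t : NNReal, (s : ℝ) ≤ T + 1 → (t : ℝ) ≤ T + 1 → w ≤ |(s : ℝ) - t| → μ ≤ dist (ψ.boundaryExtension (ρ s)) (ψ.boundaryExtension (ρ t))) → (∀ s t : NNReal, (s : ℝ) ≤ T + 1 → (t : ℝ) ≤ T + 1 → c₀ / 4 ≤ |(s : ℝ) - t| → μ₀ ≤ dist (ψ.boundaryExtension (ρ s)) (ψ.boundaryExtension (ρ t))) → (∀ s s' : NNReal, (s : ℝ) ≤ T + 1 → (s' : ℝ) ≤ T + 1 → |(s : ℝ) - s'| ≤ θ + 4 * w → |U s - U s'| ≤ ρ₁) → (∀ t₁ : NNReal, (t₁ : ℝ) ≤ T → ∃ u : NNReal, (t₁ : ℝ) + 2 * θ ≤ u ∧ (u : ℝ) ≤ t₁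 + 4 * θ ∧ ρ u ∈ Literature.Probability.RandomPlanarGeometry.Loewner.domain U t₁ ∧ m₁ ≤ ‖Literature.Probability.RandomPlanarGeometry.Loewner.map U t₁ (ρ u) - U t₁‖) → (∀ t₁ : NNReal, (t₁ : ℝ) ≤ T → ∀ e ∈ E.carrier, d' ≤ Metric.infDist e ((fun u => ψ.boundaryExtension (ρ u)) '' Set.Icc 0 (T + 1) ∪ frontier E.carrier) → ψ.symm e ∈ Literature.Probability.RandomPlanarGeometry.Loewner.domain U t₁ ∧ h₀ ≤ (Literature.Probability.RandomPlanarGeometry.Loewner.map U t₁ (ψ.symm e)).im) → (∀ u : NNReal, α₀ / 2 ≤ (u : ℝ) → (u : ℝ) ≤ T + 1 → dB ≤ Metric.infDist (ψ.boundaryExtension (ρ u)) (frontier E.carrier)) → (∀ t₁ : NNReal, (t₁ : ℝ) ≤ T → ∃ C P Q : Set ℂ, (∀ p ∈ C, ∀ q ∈ C, dist p q ≤ lam) ∧ Disjoint P Q ∧ Disjoint P C ∧ Disjoint Q C ∧ P ∪ Q ∪ C = ψ '' (Literature.Probability.RandomPlanarGeometry.Loewner.domain U t₁) ∧ (∀ S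 : Set ℂ, IsPreconnected S → S ⊆ P ∪ Q → S ⊆ P ∨ S ⊆ Q) ∧ (∀ y : ℂ, 0 < y.im → dist y (U t₁) ≤ r₁ → ψ (Literature.Probability.RandomPlanarGeometry.Loewner.loewnerInv U t₁ y) ∈ P) ∧ (∀ y : ℂ, 0 < y.im → Rout ≤ dist y (U t₁) → ψ (Literature.Probability.RandomPlanarGeometry.Loewner.loewnerInv U t₁ y) ∈ Q)) → ∀ t : NNReal, (t : ℝ) ≤ T → ∀ ut : NNReal, α₀ ≤ (ut : ℝ) → (ut : ℝ) ≤ T + 1 → dist (ψ.boundaryExtension (ζ t)) (ψ.boundaryExtension (ρ ut)) ≤ 2 * ε → (∃ s : NNReal, s ≤ t ∧ ∃ us : NNReal, (us : ℝ) ≤ T + 1 ∧ dist (ψ.boundaryExtension (ζ s)) (ψ.boundaryExtension (ρ us)) ≤ 2 * ε ∧ (ut : ℝ) + c₀ ≤ us) → ∀ e ∈ E.carrier, dist e (ψ.boundaryExtension (ζ t)) ≤ 2 * dS → d' ≤ Metric.infDist e ((fun u => ψ.boundaryExtension (ρ u)) '' Set.Icc 0 (T + 1) ∪ frontier E.carrier)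 → ∃ s : NNReal, s < t ∧ ψ.boundaryExtension (ζ s) ∈ segment ℝ (ψ.boundaryExtension (ζ t)) e :=
  -- LANDED: p162909 (Theorems/SAWReversalUpgradePathUpgradeRFlank.lean)
  Summit.CriticalPhenomena.SAWScalingLimit.Theorems.stub_flank

/-- `stub_compat` (= `Compat`; metric, M; LANDED p162651). Case `|u₁' - u₂'| ≤ c₁`: five-term triangle inequality against `μ₀`.
Case `u₁' < u₂' - c₁`: the backward past `X[v_b, 1] = Xb[0, u₁']` contains a point at `r`-level `≈ u₁` (near `r' u₁'`)
and — by no-escape and the top point near `r (T+1)` — the whole `X`-arc up to a point at level `T + 1`; a coarse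
intermediate-value argument along it yields a point at level `≈ u₂`, `ε'`-close to some `r' s₃`, `s₃ ≤ u₁'`; then
`r' s₃` and `r' u₂'` are `3ε + 3ε' + ν`-close, so `|s₃ - u₂'| < w''` by `r'`-injectivity, contradicting `s₃ ≤ u₁' < u₂' - c₁`. -/
theorem stub_compat : ∀ (X : Literature.Probability.RandomPlanarGeometry.Curve ℂ), Function.Injective X → ∀ (Xf Xb r r' : NNReal → ℂ) (T T' : NNReal) (utop : unitInterval) (b : ℂ) (ε ε' μ ν μ'' μ₀ w w'' c₀ c₁ Ttop rb rb' : ℝ), Continuous Xf → Continuous Xb → Continuous r → Continuous r' → 0 < ε → 0 < ε' → 0 < w → 0 < w'' → w'' ≤ c₁ → 0 < c₀ → 3 * w ≤ c₀ → 3 * ε + 3 * ε' < μ → 3 * ε + 3 * ε' + ν < μ'' → 0 < rb → rb < rb' → Ttop + 3 * w ≤ T + 1 → (∀ t : NNReal, (t : ℝ) ≤ T + 1 → ∃ u : unitInterval, X u = Xf t ∧ X '' Set.Icc 0 u = Xf '' Set.Icc 0 t) → (∀ t : NNReal, (t : ℝ) ≤ T' + 1 → ∃ u : unitInterval, X u =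 Xb t ∧ X '' Set.Icc u 1 = Xb '' Set.Icc 0 t) → X utop = Xf (T + 1) → X '' Set.Icc 0 utop = Xf '' Set.Icc 0 (T + 1) → (∀ t : NNReal, (t : ℝ) ≤ T + 1 → Metric.hausdorffDist (Xf '' Set.Icc 0 t) (r '' Set.Icc 0 t) ≤ ε) → (∀ t : NNReal, (t : ℝ) ≤ T' + 1 → Metric.hausdorffDist (Xb '' Set.Icc 0 t) (r' '' Set.Icc 0 t) ≤ ε') → (∀ s t : NNReal, (s : ℝ) ≤ T + 1 → (t : ℝ) ≤ T + 1 → w ≤ |(s : ℝ) - t| → μ ≤ dist (r s) (r t)) → (∀ s t : NNReal, (s : ℝ) ≤ T + 1 → (t : ℝ) ≤ T + 1 → |(s : ℝ) - t| ≤ 2 * w → dist (r s) (r t) ≤ ν) → (∀ s t : NNReal, (s : ℝ) ≤ T + 1 → (t : ℝ) ≤ T + 1 → c₀ / 4 ≤ |(s : ℝ) - t| → μ₀ ≤ dist (r s) (r t)) → (∀ s t : NNReal, (s : ℝ) ≤ T' + 1 → (t : ℝ) ≤ T' + 1 → w'' ≤ |(s : ℝ) - t| → μ'' ≤ dist (r'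 s) (r' t)) → (∀ s t : NNReal, (s : ℝ) ≤ T' + 1 → (t : ℝ) ≤ T' + 1 → |(s : ℝ) - t| ≤ c₁ → dist (r' s) (r' t) < μ₀ - 4 * ε - 4 * ε') → (∀ u : NNReal, (u : ℝ) ≤ Ttop + 2 * w → rb' + 2 * ε + 3 * ε' < dist (r u) b) → dist (r (T + 1)) b + ε ≤ rb → (∀ v : unitInterval, utop < v → dist (X v) b < rb) → (∀ v v' : unitInterval, v ≤ v' → dist (X v) b ≤ rb → dist (X v') b < rb') → ∀ v₁ v₂ : unitInterval, ∀ u₁ u₂ : NNReal, (u₂ : ℝ) ≤ Ttop → dist (X v₁) (r u₁) ≤ 2 * ε → dist (X v₂) (r u₂) ≤ 2 * ε → (u₁ : ℝ) + 2 * c₀ ≤ u₂ → ∀ u₁' u₂' : NNReal, (u₁' : ℝ) ≤ T' + 1 → (u₂' : ℝ) ≤ T' + 1 → dist (X v₁) (r' u₁') ≤ 2 * ε' → dist (X v₂) (r' u₂') ≤ 2 * ε' → (u₂' : ℝ) + c₁ ≤ u₁' :=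
  -- LANDED: p162651 (Theorems/SAWReversalUpgradePathUpgradeRCompat.lean)
  Summit.CriticalPhenomena.SAWScalingLimit.Theorems.stub_compat

/-- `stub_returnsDie` (= `ReturnsDie`; the lead's stub, XL): the probabilistic wrapper (windows from H6/H7 and the capacity
clause of `LatticeDictionary`, `Good` sets of drivers and their closure property via `SLEHullPackage`/KS 5.4, union bound with
`LawClosed (→)` in both directions, non-describable classes via the atomless law of `B_T`) around the deterministic CORE
(return ⇒ level drawdown ⇒ mid-level point `x₀`, far point `e₊`, extremal strand point on `segment x₀ e₊`, forward- or
backward-sub-front by `stub_compat`, flanked by `stub_flank` with the gate of `stub_gate`: contradiction). -/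
theorem stub_returnsDie : ∀ (D : Literature.Probability.RandomPlanarGeometry.DobrushinDomain) (φ : Literature.Probability.RandomPlanarGeometry.ConformalEquiv UpperHalfPlane.upperHalfPlaneSet D.carrier), D.IsChordalUniformizing φ → ∀ (φ' : Literature.Probability.RandomPlanarGeometry.ConformalEquiv UpperHalfPlane.upperHalfPlaneSet D.swap.carrier), D.swap.IsChordalUniformizing φ' → ∀ (Ω : ℝ → Type) [∀ δ, MeasurableSpace (Ω δ)] (X : (δ : ℝ) → Ω δ → Literature.Probability.RandomPlanarGeometry.Curve ℂ) (P : (δ : ℝ) → MeasureTheory.Measure (Ω δ)), (∀ᶠ δ in (nhdsWithin (0:ℝ) (Set.Ioi 0)), MeasureTheory.IsProbabilityMeasure (P δ)) → (∀ᶠ δ in (nhdsWithin (0:ℝ) (Set.Ioi 0)), AEMeasurable (fun ω => Literature.Probability.RandomPlanarGeometry.CurveClass.mk (X δ ω)) (P δ)) → (∀ᶠ δ in (nhdsWithin (0:ℝ) (Set.Ioi 0)), ∀ ω : Ω δ, Function.Injective (X δ ω) ∧ (X δ ω).source = D.pt 0 ∧ (X δ ω).target = D.pt 1 ∧ ∀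 t : unitInterval, X δ ω t = D.pt 0 ∨ X δ ω t = D.pt 1 ∨ X δ ω t ∈ D.carrier) → (∀ T : NNReal, Literature.Probability.RandomPlanarGeometry.TendstoLaw (fun δ (ω : Ω δ) => ((⟨Literature.Probability.RandomPlanarGeometry.drivingFunction (φ) (Literature.Probability.RandomPlanarGeometry.CurveClass.mk (X δ ω)), Literature.Probability.RandomPlanarGeometry.continuous_drivingFunction (φ) (Literature.Probability.RandomPlanarGeometry.CurveClass.mk (X δ ω))⟩ : C(NNReal, ℝ)).restrict (Set.Icc (0:NNReal) T))) P (fun ω : NNReal → ℝ => ((⟨Literature.Probability.RandomPlanarGeometry.sleDriving ((8:NNReal)/3) ω, Literature.Probability.RandomPlanarGeometry.continuous_sleDriving ((8:NNReal)/3) ω⟩ : C(NNReal, ℝ)).restrict (Set.Icc (0:NNReal) T))) Literature.Probability.Process.preWienerMeasure) → (∀ T : NNReal, Literature.Probability.RandomPlanarGeometry.TendstoLaw (fun δ (ω : Ω δ) => ((⟨Literature.Probability.RandomPlanarGeometry.drivingFunction (φ') ((Literature.Probability.RandomPlanarGeometry.CurveClass.mk (X δ ω)).reverse), Literature.Probability.RandomPlanarGeometry.continuous_drivingFunction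 (φ') ((Literature.Probability.RandomPlanarGeometry.CurveClass.mk (X δ ω)).reverse)⟩ : C(NNReal, ℝ)).restrict (Set.Icc (0:NNReal) T))) P (fun ω : NNReal → ℝ => ((⟨Literature.Probability.RandomPlanarGeometry.sleDriving ((8:NNReal)/3) ω, Literature.Probability.RandomPlanarGeometry.continuous_sleDriving ((8:NNReal)/3) ω⟩ : C(NNReal, ℝ)).restrict (Set.Icc (0:NNReal) T))) Literature.Probability.Process.preWienerMeasure) → (∀ ε : ℝ, 0 < ε → ∀ η : ℝ, 0 < η → ∃ r : ℝ, 0 < r ∧ ∀ᶠ δ in (nhdsWithin (0:ℝ) (Set.Ioi 0)), P δ {ω | ∃ s t : unitInterval, s < t ∧ ε ≤ dist (X δ ω s) (D.pt 0) ∧ dist (X δ ω t) (D.pt 0) ≤ r} ≤ ENNReal.ofReal η) → (∀ ε : ℝ, 0 < ε → ∀ η : ℝ, 0 < η → ∃ r : ℝ, 0 < r ∧ ∀ᶠ δ in (nhdsWithin (0:ℝ) (Set.Ioi 0)), P δ {ω | ∃ s t : unitInterval, s < t ∧ dist (X δ ω s) (D.pt 1) ≤ r ∧ ε ≤ dist (X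 δ ω t) (D.pt 1)} ≤ ENNReal.ofReal η) → ∀ ℓ : ℝ, 0 < ℓ → ∀ η : ℝ, 0 < η → ∃ κ : ℝ, 0 < κ ∧ ∀ᶠ δ in (nhdsWithin (0:ℝ) (Set.Ioi 0)), P δ {ω | ∃ s u t : unitInterval, s < u ∧ u < t ∧ ℓ ≤ dist (X δ ω s) (X δ ω u) ∧ dist (X δ ω s) (X δ ω t) ≤ κ} ≤ ENNReal.ofReal η :=
  -- LANDED: p167961 (Theorems/SAWReversalUpgradePathUpgradeRReturnsDie.lean; via stub_flankL p166083, quantile/perturbation stubs, Asm phases)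
  Summit.CriticalPhenomena.SAWScalingLimit.Theorems.stub_returnsDie

/-- `stub_upgradeOfReturns` (= `UpgradeOfReturns`): LANDED (p158138). -/
theorem stub_upgradeOfReturns : ∀ (D : Literature.Probability.RandomPlanarGeometry.DobrushinDomain) (Ω : ℝ → Type) [∀ δ, MeasurableSpace (Ω δ)] (X : (δ : ℝ) → Ω δ → Literature.Probability.RandomPlanarGeometry.Curve ℂ) (P : (δ : ℝ) → MeasureTheory.Measure (Ω δ)) (Γ : (NNReal → ℝ) → Literature.Probability.RandomPlanarGeometry.CurveClass ℂ), Literature.Probability.RandomPlanarGeometry.IsSLECurve ((8:NNReal)/3) D Γ → (∀ᶠ δ in (nhdsWithin (0:ℝ) (Set.Ioi 0)), AEMeasurable (fun ω => Literature.Probability.RandomPlanarGeometry.CurveClass.mk (X δ ω)) (P δ)) → Literature.Probability.RandomPlanarGeometry.TendstoLaw (fun δ (ω : Ω δ) => (⟨⟨(Literature.Probability.RandomPlanarGeometry.CurveClass.mk (X δ ω)).range, (Literature.Probability.RandomPlanarGeometry.CurveClass.mk (X δ ω)).isCompact_range⟩, (Literature.Probability.RandomPlanarGeometry.CurveClass.mk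 (X δ ω)).range_nonempty⟩ : TopologicalSpace.NonemptyCompacts ℂ)) P (fun ω => (⟨⟨(Γ ω).range, (Γ ω).isCompact_range⟩, (Γ ω).range_nonempty⟩ : TopologicalSpace.NonemptyCompacts ℂ)) Literature.Probability.Process.preWienerMeasure → (∀ᶠ δ in (nhdsWithin (0:ℝ) (Set.Ioi 0)), ∀ ω : Ω δ, (X δ ω).source = D.pt 0 ∧ (X δ ω).target = D.pt 1) → (∀ ℓ : ℝ, 0 < ℓ → ∀ η : ℝ, 0 < η → ∃ κ : ℝ, 0 < κ ∧ ∀ᶠ δ in (nhdsWithin (0:ℝ) (Set.Ioi 0)), P δ {ω | ∃ s u t : unitInterval, s < u ∧ u < t ∧ ℓ ≤ dist (X δ ω s) (X δ ω u) ∧ dist (X δ ω s) (X δ ω t) ≤ κ} ≤ ENNReal.ofReal η) → Literature.Probability.RandomPlanarGeometry.ConvergesInLawToSLE ((8:NNReal)/3) D (fun δ (ω : Ω δ) => Literature.Probability.RandomPlanarGeometry.CurveClass.mk (X δ ω)) P :=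
  Summit.CriticalPhenomena.SAWScalingLimit.Theorems.stub_upgradeOfReturns

/-! ### Definitional identification of the stubs with the named statements -/

theorem hullHausdorff_holds : HullHausdorff := stub_hullHausdorff
theorem lawClosed_holds : LawClosed := stub_lawClosed
theorem sleHullPackage_holds : HullHausdorff → SLEHullPackage := stub_sleHullPackage
theorem latticeDictionary_holds : LatticeDictionary := stub_latticeDictionary
theorem rangeBound_holds : RangeBound := stub_rangeBound
theorem gate_holds : Gate := stub_gate
theorem flank_holds : Flank := stub_flank
theorem compat_holds : Compat := stub_compat
theorem returnsDie_holds : ReturnsDie := stub_returnsDie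
theorem upgradeOfReturns_holds : UpgradeOfReturns := stub_upgradeOfReturns

/-! ### Name-keyed aliases (the skeleton audit admits a `Prop` hypothesis only by the NAME of a stub) -/
namespace __Registered

/-- Alias keyed by the registered stub name. -/
abbrev stub_hullHausdorff : Prop := HullHausdorff
/-- Alias keyed by the registered stub name. -/
abbrev stub_lawClosed : Prop := LawClosed
/-- Alias keyed by the registered stub name. -/
abbrev stub_sleHullPackage : Prop := HullHausdorff → SLEHullPackage
/-- Alias keyed by the registered stub name. -/
abbrev stub_latticeDictionary : Prop := LatticeDictionary
/-- Alias keyed by the registered stub name. -/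
abbrev stub_rangeBound : Prop := RangeBound
/-- Alias keyed by the registered stub name. -/
abbrev stub_gate : Prop := Gate
/-- Alias keyed by the registered stub name. -/
abbrev stub_flank : Prop := Flank
/-- Alias keyed by the registered stub name. -/
abbrev stub_compat : Prop := Compat
/-- Alias keyed by the registered stub name. -/
abbrev stub_returnsDie : Prop := ReturnsDie
/-- Alias keyed by the registered stub name. -/
abbrev stub_upgradeOfReturns : Prop := UpgradeOfReturns

end __Registered

/-! ### The skeleton theorem: the stubs imply the crux `PathUpgradeR`, BY NAME -/

open Literature.Probability.RandomPlanarGeometry in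
/-- **`PathUpgradeR` from the line `bidir_windows`** (kernel-checked glue, no `sorry` of its own):
`stub_rangeBound` (fed `stub_lawClosed`, `stub_sleHullPackage ∘ stub_hullHausdorff`, `stub_latticeDictionary`)
gives an SLE_(8/3) curve `Γ` and the closed-set bound for the ranges; `stub_lawClosed (←)` on
`NonemptyCompacts ℂ` (Borel σ-algebra, `1`-Lipschitz range map) turns it into the range `TendstoLaw`;
`stub_returnsDie` gives returns dying in law; H3 the eventual endpoints; `stub_upgradeOfReturns` concludes. -/
theorem PathUpgradeR_of (h6 : __Registered.stub_returnsDie) :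
    Summit.CriticalPhenomena.SAWScalingLimit.Theses.SAWReversalUpgrade.PathUpgradeR := by
  intro D φ hφ φ' hφ' Ω _ X P hP hmeas hsimple hfwd hbwd hH6 hH7
  have hHH : HullHausdorff := hullHausdorff_holds  -- LANDED (p161175), discharged here
  have hLC : LawClosed := lawClosed_holds  -- LANDED (p160537), discharged here
  have hPK : SLEHullPackage := sleHullPackage_holds hHH  -- LANDED (p160796), discharged here
  have hLD : LatticeDictionary := latticeDictionary_holds  -- LANDED (p160945), discharged here
  have hRB : RangeBound := rangeBound_holds  -- LANDED (p162480), discharged here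
  have hRD : ReturnsDie := h6
  have _hGFC : Gate ∧ Flank ∧ Compat := ⟨gate_holds, flank_holds, compat_holds⟩  -- ALL LANDED (p162698, p162909, p162651): the deterministic stubs behind `stub_returnsDie`
  have hUP : UpgradeOfReturns := upgradeOfReturns_holds  -- LANDED (p158138), discharged here
  obtain ⟨Γ, hΓ, hbound⟩ := hRB D φ hφ Ω X P hP hmeas hsimple hfwd hH7
  -- the range law from the closed-set bound
  letI : MeasurableSpace (TopologicalSpace.NonemptyCompacts ℂ) := borel _
  haveI : BorelSpace (TopologicalSpace.NonemptyCompacts ℂ) := ⟨rfl⟩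
  haveI : MeasureTheory.IsProbabilityMeasure Literature.Probability.Process.preWienerMeasure :=
    isProbabilityMeasure_preWienerMeasure'
  set R : CurveClass ℂ → TopologicalSpace.NonemptyCompacts ℂ :=
    fun γ ↦ ⟨⟨γ.range, γ.isCompact_range⟩, γ.range_nonempty⟩ with hR
  have hRc : Continuous R := by
    refine (LipschitzWith.mk_one fun c c' ↦ ?_).continuous
    rw [Metric.NonemptyCompacts.dist_eq]
    exact CurveClass.hausdorffDist_range_le_dist c c'
  have hmeasR : ∀ᶠ δ in (nhdsWithin (0:ℝ) (Set.Ioi 0)), AEMeasurable (fun ω => R (CurveClass.mk (X δ ω))) (P δ) := by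
    filter_upwards [hmeas] with δ hδ
    exact hRc.measurable.comp_aemeasurable hδ
  have hmeasΓ : AEMeasurable (fun ω => R (Γ ω)) Literature.Probability.Process.preWienerMeasure :=
    hRc.measurable.comp_aemeasurable hΓ.aemeasurable
  have hrange : TendstoLaw (fun δ (ω : Ω δ) => R (CurveClass.mk (X δ ω))) P (fun ω => R (Γ ω))
      Literature.Probability.Process.preWienerMeasure :=
    (hLC (TopologicalSpace.NonemptyCompacts ℂ) Ω (NNReal → ℝ) (fun δ (ω : Ω δ) => R (CurveClass.mk (X δ ω)))
      P (fun ω => R (Γ ω)) Literature.Probability.Process.preWienerMeasure inferInstance hP hmeasR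
      hmeasΓ).2 hbound
  have hret := hRD D φ hφ φ' hφ' Ω X P hP hmeas hsimple hfwd hbwd hH6 hH7
  have hend : ∀ᶠ δ in (nhdsWithin (0:ℝ) (Set.Ioi 0)), ∀ ω : Ω δ,
      (X δ ω).source = D.pt 0 ∧ (X δ ω).target = D.pt 1 :=
    hsimple.mono fun δ h ω => ⟨(h ω).2.1, (h ω).2.2.1⟩
  exact hUP D Ω X P Γ hΓ hmeas hrange hend hret

/-- Wiring check (an `example`, so that `PathUpgradeR_of` stays the only theorem concluding the crux):
the crux BY NAME from the stubs. -/
example : Summit.CriticalPhenomena.SAWScalingLimit.Theses.SAWReversalUpgrade.PathUpgradeR :=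
  PathUpgradeR_of stub_returnsDie

end Summit.CriticalPhenomena.SAWScalingLimit.Cruxes.PathUpgradeR.BidirWindows
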